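import Summits.ValiantsHypothesis.ValiantsHypothesis.Theorems.NewtonUnitEquationsNewtonTauWeakAlignedPeelingDefs
import Summits.ValiantsHypothesis.ValiantsHypothesis.Theorems.DissociatedFixedK.Negative.LoadBearing
import Summits.ValiantsHypothesis.ValiantsHypothesis.Theorems.NewtonUnitEquationsTwoProductsExposure

/-!
# `NewtonTauWeak` (stmt-ValiantsHypothesis-5904), line `aligned-peeling` — refutation of its load-bearing stub,
# part 1: all-ones products, sumsets, and the vertex-count interface (negative lane)

The registered line `Cruxes/NewtonTauWeak/Lines/aligned_peeling.lean` closes the crux modulo the single stub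
`stub_alignedPeeling : ∃ C c, AlignedPeeling C c` (objects landed verbatim in
`Theorems/NewtonUnitEquationsNewtonTauWeakAlignedPeelingDefs.lean`).  This series of files
(`Theorems/NewtonTauWeak/Negative/AlignedPeeling*.lean`) proves that stub FALSE: an explicit family with `k = 2`,
`t = 6` FIXED (the "two-level corner design" on the standard triangle: products of all-ones 6-nomials whose supports
are the three corners plus, per factor, one guard/chain point near each corner) has aligned bound `V = 5` for every
aligned combination while `vert(p₁ P + p₂ · 1)` grows linearly in the number of factors.  The LINE dies; the crux
`NewtonTauWeak` itself stays OPEN, and nothing here bears on `VP ≠ VNP`.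

This file (generic tools, no design yet):
* `onesPoly T = Σ_{e ∈ T} X^e`, `sumset T` (all `Σ_i f(i)`, `f(i) ∈ T_i`), `coeff_prod_onesPoly` (the coefficient of
  `Π_i onesPoly (T i)` at `e` is the NUMBER of representations), `support_prod_onesPoly` (support = sumset),
  `coeff_prod_onesPoly_eq_one` (uniquely represented points);
* real forms on lattice points `fv ξ₀ ξ₁ e = ξ₀ e₀ + ξ₁ e₁`, the predicate `IsUniqueMin` (unique minimiser over a
  finite set), and the two-sided interface to the crux's vertex count `vert`:
  `card_le_vert` (strictly exposed support points are vertices — via `mem_extremePoints_convexHull_of_strict_sep`)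
  and `vert_le_card` (every vertex is the unique minimiser of a real form — via
  `TwoProducts.Exposure.exists_real_form_of_mem_extremePoints`).
[folklore]
-/

set_option linter.dupNamespace false

namespace Summit.ValiantsHypothesis.ValiantsHypothesis.Theorems.NewtonTauWeak.Negative.AlignedPeelingCex

open scoped BigOperators
open MvPolynomial Finset
open Summit.ValiantsHypothesis.ValiantsHypothesis.Theorems.NewtonTauWeak.Negative (vert)
open Summit.ValiantsHypothesis.ValiantsHypothesis.Theorems.DissociatedFixedK.Negative
  (emb emb_injective mem_extremePoints_convexHull_of_strict_sep)
open Summit.ValiantsHypothesis.ValiantsHypothesis.Theorems.TwoProducts.Exposure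
  (exists_real_form_of_mem_extremePoints)

noncomputable section

/-! ## A.1 All-ones polynomials and sumsets -/

/-- The all-ones polynomial on a finite exponent set `T`: `Σ_{e ∈ T} X^e`. [folklore] -/
def onesPoly (T : Finset (Fin 2 →₀ ℕ)) : MvPolynomial (Fin 2) ℂ := ∑ e ∈ T, monomial e 1

/-- Coefficients of the all-ones polynomial: the indicator of `T`. -/
theorem coeff_onesPoly (T : Finset (Fin 2 →₀ ℕ)) (e : Fin 2 →₀ ℕ) :
    coeff e (onesPoly T) = if e ∈ T then 1 else 0 := by
  classical
  unfold onesPoly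
  rw [coeff_sum]
  simp_rw [coeff_monomial]
  rw [Finset.sum_ite_eq' T e]

/-- The support of the all-ones polynomial on `T` is `T`. -/
theorem support_onesPoly (T : Finset (Fin 2 →₀ ℕ)) : (onesPoly T).support = T := by
  ext e
  rw [mem_support_iff, coeff_onesPoly]
  split_ifs with h <;> simp [h]

/-- The sumset `T₀ + ⋯ + T_{ℓ-1}` of a family of finite exponent sets: all sums `Σ_i f(i)`, `f(i) ∈ T_i`. [folklore] -/
def sumset {ℓ : ℕ} (T : Fin ℓ → Finset (Fin 2 →₀ ℕ)) : Finset (Fin 2 →₀ ℕ) :=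
  (Fintype.piFinset T).image fun f => ∑ i, f i

/-- Membership in the sumset. -/
theorem mem_sumset_iff {ℓ : ℕ} (T : Fin ℓ → Finset (Fin 2 →₀ ℕ)) (e : Fin 2 →₀ ℕ) :
    e ∈ sumset T ↔ ∃ f ∈ Fintype.piFinset T, ∑ i, f i = e := by
  simp [sumset]

/-- A choice function gives a sumset element. -/
theorem sum_mem_sumset {ℓ : ℕ} (T : Fin ℓ → Finset (Fin 2 →₀ ℕ)) (f : Fin ℓ → (Fin 2 →₀ ℕ))
    (hf : ∀ i, f i ∈ T i) : ∑ i, f i ∈ sumset T :=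
  (mem_sumset_iff T _).mpr ⟨f, Fintype.mem_piFinset.mpr hf, rfl⟩

/-- Expansion of a product of all-ones polynomials over choice functions. -/
theorem prod_onesPoly_eq_sum {ℓ : ℕ} (T : Fin ℓ → Finset (Fin 2 →₀ ℕ)) :
    ∏ i, onesPoly (T i) = ∑ f ∈ Fintype.piFinset T, monomial (∑ i, f i) (1 : ℂ) := by
  unfold onesPoly
  rw [Finset.prod_univ_sum]
  refine Finset.sum_congr rfl fun f _ => ?_
  rw [monomial_sum_one]

/-- Coefficient of a product of all-ones polynomials = number of representations. -/
theorem coeff_prod_onesPoly {ℓ : ℕ} (T : Fin ℓ → Finset (Fin 2 →₀ ℕ)) (e : Fin 2 →₀ ℕ) :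
    coeff e (∏ i, onesPoly (T i)) =
      (((Fintype.piFinset T).filter fun f => ∑ i, f i = e).card : ℂ) := by
  classical
  rw [prod_onesPoly_eq_sum, coeff_sum]
  simp only [coeff_monomial]
  rw [Finset.sum_boole]

/-- The support of a product of all-ones polynomials is the sumset of the exponent sets. -/
theorem support_prod_onesPoly {ℓ : ℕ} (T : Fin ℓ → Finset (Fin 2 →₀ ℕ)) :
    (∏ i, onesPoly (T i)).support = sumset T := by
  classical
  ext e
  rw [mem_support_iff, coeff_prod_onesPoly, Nat.cast_ne_zero, ← pos_iff_ne_zero, Finset.card_pos,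
    mem_sumset_iff]
  constructor
  · rintro ⟨f, hf⟩
    rw [Finset.mem_filter] at hf
    exact ⟨f, hf.1, hf.2⟩
  · rintro ⟨f, hf, hfe⟩
    exact ⟨f, Finset.mem_filter.mpr ⟨hf, hfe⟩⟩

/-- A uniquely represented point has coefficient `1` in the product of all-ones polynomials. -/
theorem coeff_prod_onesPoly_eq_one {ℓ : ℕ} (T : Fin ℓ → Finset (Fin 2 →₀ ℕ)) (e : Fin 2 →₀ ℕ)
    (f₀ : Fin ℓ → (Fin 2 →₀ ℕ)) (hf₀ : ∀ i, f₀ i ∈ T i) (he : ∑ i, f₀ i = e)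
    (huniq : ∀ f : Fin ℓ → (Fin 2 →₀ ℕ), (∀ i, f i ∈ T i) → ∑ i, f i = e → f = f₀) :
    coeff e (∏ i, onesPoly (T i)) = 1 := by
  classical
  rw [coeff_prod_onesPoly]
  have : ((Fintype.piFinset T).filter fun f => ∑ i, f i = e) = {f₀} := by
    ext f
    simp only [Finset.mem_filter, Finset.mem_singleton, Fintype.mem_piFinset]
    constructor
    · rintro ⟨hf, hfe⟩
      exact huniq f hf hfe
    · rintro rfl
      exact ⟨hf₀, he⟩
  rw [this, Finset.card_singleton, Nat.cast_one]

/-! ## A.2 Real forms on lattice points and the vertex-count interface -/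

/-- Value of the real linear form `(ξ₀, ξ₁)` at a lattice point. [folklore] -/
def fv (ξ₀ ξ₁ : ℝ) (e : Fin 2 →₀ ℕ) : ℝ := ξ₀ * (e 0 : ℝ) + ξ₁ * (e 1 : ℝ)

/-- Additivity of the form value. -/
theorem fv_add (ξ₀ ξ₁ : ℝ) (e e' : Fin 2 →₀ ℕ) : fv ξ₀ ξ₁ (e + e') = fv ξ₀ ξ₁ e + fv ξ₀ ξ₁ e' := by
  simp only [fv, Finsupp.add_apply, Nat.cast_add]
  ring

/-- The form value as an additive monoid hom. -/
def fvHom (ξ₀ ξ₁ : ℝ) : (Fin 2 →₀ ℕ) →+ ℝ where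
  toFun := fv ξ₀ ξ₁
  map_zero' := by simp [fv]
  map_add' := fv_add ξ₀ ξ₁

/-- The form value of a finite sum. -/
theorem fv_sum (ξ₀ ξ₁ : ℝ) {ι : Type*} (s : Finset ι) (f : ι → (Fin 2 →₀ ℕ)) :
    fv ξ₀ ξ₁ (∑ i ∈ s, f i) = ∑ i ∈ s, fv ξ₀ ξ₁ (f i) :=
  map_sum (fvHom ξ₀ ξ₁) f s

/-- The form value of a multiple. -/
theorem fv_nsmul (ξ₀ ξ₁ : ℝ) (n : ℕ) (e : Fin 2 →₀ ℕ) : fv ξ₀ ξ₁ (n • e) = n * fv ξ₀ ξ₁ e := by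
  rw [show fv ξ₀ ξ₁ (n • e) = fvHom ξ₀ ξ₁ (n • e) from rfl, map_nsmul, nsmul_eq_mul]
  rfl

/-- `e` is the UNIQUE minimiser of the form `(ξ₀, ξ₁)` over the finite set `A`. [folklore] -/
structure IsUniqueMin (ξ₀ ξ₁ : ℝ) (A : Finset (Fin 2 →₀ ℕ)) (e : Fin 2 →₀ ℕ) : Prop where
  /-- the point lies in the set -/
  mem : e ∈ A
  /-- every other point of the set has a strictly larger form value -/
  lt : ∀ e' ∈ A, e' ≠ e → fv ξ₀ ξ₁ e < fv ξ₀ ξ₁ e'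

/-- The linear functional on `ℝ²` with coefficients `(ξ₀, ξ₁)`. -/
def form (ξ₀ ξ₁ : ℝ) : (Fin 2 → ℝ) →ₗ[ℝ] ℝ := ξ₀ • LinearMap.proj 0 + ξ₁ • LinearMap.proj 1

/-- The functional `form` restricted to embedded lattice points is `fv`. -/
theorem form_emb (ξ₀ ξ₁ : ℝ) (e : Fin 2 →₀ ℕ) : form ξ₀ ξ₁ (emb e) = fv ξ₀ ξ₁ e := by
  simp [form, emb, fv]

/-- LOWER BOUND INTERFACE: a set of support points each of which is the unique minimiser of some real form over
the support consists of hull vertices, so `#W ≤ vert p`. -/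
theorem card_le_vert (p : MvPolynomial (Fin 2) ℂ) (W : Finset (Fin 2 →₀ ℕ))
    (hW : ∀ e ∈ W, ∃ ξ₀ ξ₁ : ℝ, IsUniqueMin ξ₀ ξ₁ p.support e) : W.card ≤ vert p := by
  unfold vert
  change W.card ≤ (Set.extremePoints ℝ (convexHull ℝ (emb '' (p.support : Set (Fin 2 →₀ ℕ))))).ncard
  have hsub : emb '' (W : Set (Fin 2 →₀ ℕ)) ⊆
      Set.extremePoints ℝ (convexHull ℝ (emb '' (p.support : Set (Fin 2 →₀ ℕ)))) := by
    rintro _ ⟨e, he, rfl⟩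
    obtain ⟨ξ₀, ξ₁, hmem, hmin⟩ := hW e he
    refine mem_extremePoints_convexHull_of_strict_sep ⟨e, hmem, rfl⟩ (-(form ξ₀ ξ₁)) ?_
    rintro _ ⟨e', he', rfl⟩ hne
    have hne' : e' ≠ e := fun h => hne (by rw [h])
    have hlt := hmin e' he' hne'
    simp only [LinearMap.neg_apply, form_emb]
    linarith
  have hfin : (Set.extremePoints ℝ (convexHull ℝ (emb '' (p.support : Set (Fin 2 →₀ ℕ))))).Finite :=
    (p.support.finite_toSet.image emb).subset extremePoints_convexHull_subset
  calc W.card = (emb '' (W : Set (Fin 2 →₀ ℕ))).ncard := by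
        rw [Set.ncard_image_of_injective _ emb_injective, Set.ncard_coe_finset]
    _ ≤ _ := Set.ncard_le_ncard hsub hfin

/-- UPPER BOUND INTERFACE: if every unique minimiser (over the support) of every real form lies in `K`, then
`vert p ≤ #K` (every hull vertex is strictly exposed by a real form). -/
theorem vert_le_card (p : MvPolynomial (Fin 2) ℂ) (K : Finset (Fin 2 →₀ ℕ))
    (hK : ∀ (ξ₀ ξ₁ : ℝ) (e : Fin 2 →₀ ℕ), IsUniqueMin ξ₀ ξ₁ p.support e → e ∈ K) : vert p ≤ K.card := by
  unfold vert
  change (Set.extremePoints ℝ (convexHull ℝ (emb '' (p.support : Set (Fin 2 →₀ ℕ))))).ncard ≤ K.card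
  have hsub : Set.extremePoints ℝ (convexHull ℝ (emb '' (p.support : Set (Fin 2 →₀ ℕ)))) ⊆
      emb '' (K : Set (Fin 2 →₀ ℕ)) := by
    intro x hx
    obtain ⟨hxT, ξ, hξ⟩ :=
      exists_real_form_of_mem_extremePoints _ (p.support.finite_toSet.image emb) x hx
    obtain ⟨e, he, rfl⟩ := hxT
    refine ⟨e, hK (ξ 0) (ξ 1) e ⟨he, fun e' he' hne => ?_⟩, rfl⟩
    have h := hξ (emb e') ⟨e', he', rfl⟩ (fun h => hne (emb_injective h))
    simpa [emb, fv] using h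
  calc (Set.extremePoints ℝ (convexHull ℝ (emb '' (p.support : Set (Fin 2 →₀ ℕ))))).ncard
      ≤ (emb '' (K : Set (Fin 2 →₀ ℕ))).ncard := Set.ncard_le_ncard hsub (K.finite_toSet.image emb)
    _ = K.card := by rw [Set.ncard_image_of_injective _ emb_injective, Set.ncard_coe_finset]

end

end Summit.ValiantsHypothesis.ValiantsHypothesis.Theorems.NewtonTauWeak.Negative.AlignedPeelingCex
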